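import Mathlib
import Summits.ResolutionOfSingularities.ResolutionOfSingularities.Theorems.WeightedInvariantHomogeneousMinimalPrimes
import Summits.ResolutionOfSingularities.ResolutionOfSingularities.Theorems.WeightedInvariantGradedCoarsening
import HarnessLib

/-!
# G-HT: homogeneous primes have small height when the grading has homogeneous units of full rank

Cell `res-hironaka`, line `L W4.3`, door crux `HypersurfaceCentreConstruction`
(stmt-ResolutionOfSingularities-19897), E2 tier; registrar `res-L1-w43-plan-1`, ORDER (o63), SPEC (Δ7)
`GHT_sketch.lean` (3912825473c6cb9b).  Hand: `res-D-pv-031`.  Everything here is OURS: a SUPPORT statement of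
pure commutative algebra and its proof; nothing is a statement of [Hironaka2017].

The consumers ((S-c) `E2StepMaxBody`, the (o59-loc) SUP step, (o47) `E2CentreH`) apply the rung clause
(c8-gr)≤3 `IotaUpperSemicontinuousGradedLE 3 p ι` on a unit chart of a stage and therefore need:

**G-HT** (`GHTStatement`, copied VERBATIM from the SPEC).  Let `A` be a (Noetherian) commutative ring graded by
`ℤʲ` (`GradedRing 𝒜`, `𝒜 : (Fin j → ℤ) → AddSubgroup A`) possessing, for every `i`, a homogeneous UNIT of
degree `e·eᵢ` (`e ≥ 1`), and suppose `ringKrullDim A ≤ j + d`.  Then every homogeneous prime `P` has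
`ringKrullDim A_P ≤ d`.

## Proof (chain form; only inequalities, no catenarity, Noetherianity not used)

`dim A_P = ht P` (`IsLocalization.AtPrime.ringKrullDim_eq_height`).  We produce a chain of primes of length
`j` ABOVE `P`, `P = Q₀ < Q₁ < ⋯ < Qⱼ`; then `ht P + j ≤ ht Qⱼ ≤ dim A ≤ j + d`, so `ht P ≤ d`.
The chain is built one unit at a time, forgetting one coordinate of the grading at each step
(`exists_isPrime_height_add_le`): if `Q` is prime and homogeneous for the grading by the first `m + 1`
coordinates (`coarsen`, the grading `A_ψ := ⊕_{χ|_{m+1} = ψ} A_χ`) and `u` is the unit of degree `e·e_m`, then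
* `u - 1 ∉ Q` (`sub_one_not_mem`: the degree-`e·e_m` component of `u - 1` is `u`);
* `Q + (u - 1) ≠ A` (`sup_span_sub_one_ne_top`: if `a(u - 1) + b = 1` with `b ∈ Q`, look at the components
  `a_χ ∉ Q` of extreme `m`-th coordinate — the lowest one forces `χ = 0`, the highest one `χ + e·e_m = 0`,
  incompatible);
* `Q + (u - 1)` is homogeneous for the grading by the first `m` coordinates (there `u` has degree `0`), so a
  minimal prime `Q₁` over it is homogeneous for that grading (`Theorems.isHomogeneous_of_mem_minimalPrimes`,
  res-D-pv-025's transport of Mathlib's `Ideal.IsPrime.homogeneousCore` to `ℤᵐ`), and `Q < Q₁`.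

The coarsening of a grading along an additive map of degree groups (`GradedCoarsening.coarsen`,
`nonempty_gradedRing_coarsen`) and the two facts about `Q + (u - 1)` are in
`…Theorems/WeightedInvariantGradedCoarsening.lean`. [folklore; Bruns–Herzog, *Cohen–Macaulay rings* §1.5 for the
graded background]

AI-written support lemma for an AI-planned line; weaker than expert review.
-/

set_option linter.dupNamespace false -- mandated namespace of this single-conjunct summit

open DirectSum
open Summit.ResolutionOfSingularities.ResolutionOfSingularities.Theorems.GradedCoarsening

namespace Summit.ResolutionOfSingularities.ResolutionOfSingularities.Cruxes.HypersurfaceCentreConstruction.LocalEngine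

/-! ## The SPEC (Δ7) (statements verbatim; the `[folklore]` docstring tags of the two `Prop`s dropped — they are OURS interface
statements, proved in this file, not cited facts) -/

/-- **G-HT (ORDER (o63); candidate SUPPORT statement).**  In a Noetherian `ℤʲ`-graded ring of dimension `≤ j + d` possessing a
homogeneous unit of degree `e·eᵢ` for every `i` (`e ≥ 1`), every homogeneous prime has local ring of dimension `≤ d`.
[OURS · candidate · registrar SPEC (Δ7); folklore graded algebra, PROVED below as `ght_holds`] -/
def GHTStatement : Prop :=
  ∀ (j d e : ℕ), 0 < e → ∀ (A : Type) [CommRing A] [IsNoetherianRing A]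
    (𝒜 : (Fin j → ℤ) → AddSubgroup A) [GradedRing 𝒜],
    (∀ i : Fin j, ∃ u ∈ 𝒜 (Pi.single i (e : ℤ)), IsUnit u) →
    ringKrullDim A ≤ (j + d : ℕ) →
    ∀ P : PrimeSpectrum A, P.asIdeal.IsHomogeneous 𝒜 → ringKrullDim (Localization.AtPrime P.asIdeal) ≤ d

/-- **G-HT, scheme-facing corollary shape the consumers use** (same content, hypotheses as they arise on a unit chart: the units come
from `GradedAtlas.exists_unit` after localisation, the dimension bound from smoothness + (I0)₂ on the connected component).
Stated here only to fix the interface; a hand may prove `GHTStatement` and derive this, or prove this directly. [OURS · candidate;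
PROVED below as `ghtChart_holds`] -/
def GHTChartStatement : Prop :=
  ∀ (j : ℕ) (A : Type) [CommRing A] [IsNoetherianRing A]
    (𝒜 : (Fin j → ℤ) → AddSubgroup A) [GradedRing 𝒜] (e : ℕ), 0 < e →
    (∀ χ : Fin j → ℤ, ∃ u ∈ 𝒜 (e • χ), IsUnit u) →
    ringKrullDim A ≤ (j + 3 : ℕ) →
    ∀ P : PrimeSpectrum A, P.asIdeal.IsHomogeneous 𝒜 → ringKrullDim (Localization.AtPrime P.asIdeal) ≤ 3

/-- GLUE (PROVED): the chart shape follows from G-HT with `d = 3`. [OURS] [folklore] -/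
theorem ghtChart_of_ght (h : GHTStatement) : GHTChartStatement := by
  intro j A _ _ 𝒜 _ e he hu hdim P hP
  refine h j 3 e he A 𝒜 (fun i => ?_) hdim P hP
  obtain ⟨u, hu, hunit⟩ := hu (Pi.single i 1)
  refine ⟨u, ?_, hunit⟩
  have : e • (Pi.single i (1 : ℤ) : Fin j → ℤ) = Pi.single i (e : ℤ) := by
    ext i'
    by_cases hi : i' = i
    · subst hi; simp
    · simp [hi]
  rw [← this]; exact hu

namespace GHT

/-! ## The chain of primes above a homogeneous prime -/

section Chain

/-- Restriction of characters `ℤʲ → ℤᵐ` to the first `m` coordinates (`m ≤ j`). [folklore] -/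
def restr {j m : ℕ} (hm : m ≤ j) : (Fin j → ℤ) →+ (Fin m → ℤ) :=
  (LinearMap.funLeft ℤ ℤ (Fin.castLE hm)).toAddMonoidHom

/-- `restr` evaluates a character at `Fin.castLE`. [folklore] -/
@[simp] theorem restr_apply {j m : ℕ} (hm : m ≤ j) (χ : Fin j → ℤ) (i : Fin m) :
    restr hm χ i = χ (Fin.castLE hm i) :=
  rfl

variable {j : ℕ} {A : Type*} [CommRing A] (𝒜 : (Fin j → ℤ) → AddSubgroup A) [GradedRing 𝒜] {e : ℕ}

/-- **The chain.**  If `Q` is a prime homogeneous for the grading by the first `m` coordinates and there are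
homogeneous units of degrees `e·eᵢ` (`i < m`, `e ≥ 1`), then some prime `Q'` has `ht Q + m ≤ ht Q'`
(there is a chain of primes of length `m` above `Q`). [folklore] -/
theorem exists_isPrime_height_add_le (he : 0 < e)
    (hu : ∀ i : Fin j, ∃ u ∈ 𝒜 (Pi.single i (e : ℤ)), IsUnit u) :
    ∀ (m : ℕ) (hm : m ≤ j) [GradedRing (coarsen 𝒜 (restr hm))] (Q : Ideal A), Q.IsPrime →
      Q.IsHomogeneous (coarsen 𝒜 (restr hm)) → ∃ Q' : Ideal A, Q'.IsPrime ∧ Q.height + m ≤ Q'.height := by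
  intro m
  induction m with
  | zero =>
    intro hm _ Q hQ _
    exact ⟨Q, hQ, by simp⟩
  | succ m ih =>
    intro hm _ Q hQ hQhom
    classical
    -- the unit of degree `e·e_m`
    set i₀ : Fin j := ⟨m, hm⟩ with hi₀_def
    obtain ⟨u, hu𝒜, hunit⟩ := hu i₀
    have huB : u ∈ coarsen 𝒜 (restr hm) (restr hm (Pi.single i₀ (e : ℤ))) := mem_coarsen_of_mem hu𝒜
    -- its degree is detected by the last coordinate
    let φ : (Fin (m + 1) → ℤ) →+ ℤ := Pi.evalAddMonoidHom (fun _ : Fin (m + 1) => ℤ) (Fin.last m)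
    have hlast : Fin.castLE hm (Fin.last m) = i₀ := Fin.ext (by simp [hi₀_def])
    have hφδ : φ (restr hm (Pi.single i₀ (e : ℤ))) = e := by
      simp [φ, hlast]
    have hφδ_pos : 0 < φ (restr hm (Pi.single i₀ (e : ℤ))) := by
      rw [hφδ]; exact_mod_cast he
    have hδ_ne : restr hm (Pi.single i₀ (e : ℤ)) ≠ 0 := by
      intro h0; rw [h0, map_zero] at hφδ_pos; exact lt_irrefl _ hφδ_pos
    have hQtop : Q ≠ ⊤ := hQ.ne_top
    -- the step
    have hnot : u - 1 ∉ Q := sub_one_not_mem (coarsen 𝒜 (restr hm)) hQhom hQtop hδ_ne huB hunit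
    have hJtop : Q ⊔ Ideal.span {u - 1} ≠ ⊤ :=
      sup_span_sub_one_ne_top (coarsen 𝒜 (restr hm)) φ hQhom hQtop hφδ_pos huB hunit
    -- the coarser grading by the first `m` coordinates
    have hm' : m ≤ j := (Nat.le_succ m).trans hm
    obtain ⟨instB'⟩ := nonempty_gradedRing_coarsen 𝒜 (restr hm')
    let g : (Fin (m + 1) → ℤ) → (Fin m → ℤ) := fun ψ i => ψ (Fin.castSucc i)
    have hg : ∀ χ : Fin j → ℤ, restr hm' χ = g (restr hm χ) := by
      intro χ; funext i; simp only [g, restr_apply]; rfl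
    have hQhom' : Q.IsHomogeneous (coarsen 𝒜 (restr hm')) :=
      isHomogeneous_coarsen_of_isHomogeneous_coarsen hg hQhom
    have hδ' : restr hm' (Pi.single i₀ (e : ℤ)) = 0 := by
      funext i
      have hne : Fin.castLE hm' i ≠ i₀ := by
        intro h
        have h' := congrArg Fin.val h
        simp [hi₀_def] at h'
        have := i.2
        omega
      simp [hne]
    have hu0 : u ∈ coarsen 𝒜 (restr hm') 0 := hδ' ▸ mem_coarsen_of_mem hu𝒜
    have hsub : u - 1 ∈ coarsen 𝒜 (restr hm') 0 :=
      sub_mem hu0 (SetLike.one_mem_graded (coarsen 𝒜 (restr hm')))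
    have hJhom : (Q ⊔ Ideal.span {u - 1}).IsHomogeneous (coarsen 𝒜 (restr hm')) := by
      refine hQhom'.sup (Ideal.homogeneous_span _ _ ?_)
      rintro x hx
      rw [Set.mem_singleton_iff] at hx
      subst hx
      exact ⟨0, hsub⟩
    -- a minimal prime over `Q + (u - 1)`: homogeneous for the coarser grading, strictly above `Q`
    obtain ⟨M, hMmax, hJM⟩ := Ideal.exists_le_maximal _ hJtop
    haveI := hMmax.isPrime
    obtain ⟨Q₁, hQ₁min, -⟩ := Ideal.exists_minimalPrimes_le hJM
    have hQ₁ : Q₁.IsPrime := hQ₁min.1.1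
    have hJQ₁ : Q ⊔ Ideal.span {u - 1} ≤ Q₁ := hQ₁min.1.2
    have hQ₁hom : Q₁.IsHomogeneous (coarsen 𝒜 (restr hm')) :=
      Theorems.isHomogeneous_of_mem_minimalPrimes (coarsen 𝒜 (restr hm')) hJhom hQ₁min
    have hlt : Q < Q₁ := by
      refine lt_of_le_of_ne (le_sup_left.trans hJQ₁) ?_
      intro hQQ₁
      apply hnot
      rw [hQQ₁]
      exact hJQ₁ (Ideal.mem_sup_right (Ideal.subset_span rfl))
    -- induction
    obtain ⟨Q', hQ', hle⟩ := ih hm' Q₁ hQ₁ hQ₁hom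
    refine ⟨Q', hQ', ?_⟩
    haveI := hQ
    haveI := hQ₁
    have h1 : Q.height + 1 ≤ Q₁.height := Ideal.height_add_one_le_of_lt_of_isPrime hlt
    calc Q.height + ((m + 1 : ℕ) : ℕ∞) = Q.height + 1 + m := by push_cast; ring
      _ ≤ Q₁.height + m := add_le_add h1 le_rfl
      _ ≤ Q'.height := hle

end Chain

end GHT

/-! ## G-HT -/

open GHT in
/-- **G-HT holds.**  In a `ℤʲ`-graded commutative ring of Krull dimension `≤ j + d` with a homogeneous unit
of degree `e·eᵢ` for every `i` (`e ≥ 1`), every homogeneous prime `P` has `dim A_P ≤ d`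
(the Noetherian hypothesis of the SPEC is not used). [folklore] -/
theorem ght_holds : GHTStatement := by
  intro j d e he A _ _ 𝒜 _ hu hdim P hP
  obtain ⟨inst⟩ := nonempty_gradedRing_coarsen 𝒜 (restr (le_refl j))
  have hPj : P.asIdeal.IsHomogeneous (coarsen 𝒜 (restr (le_refl j))) :=
    isHomogeneous_coarsen_of_isHomogeneous hP
  obtain ⟨Q', hQ', hle⟩ := exists_isPrime_height_add_le 𝒜 he hu j le_rfl P.asIdeal P.2 hPj
  haveI := hQ'
  have h1 : (Q'.height : WithBot ℕ∞) ≤ ringKrullDim A := Ideal.height_le_ringKrullDim_of_isPrime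
  have h2 : ((P.asIdeal.height + j : ℕ∞) : WithBot ℕ∞) ≤ ((j + d : ℕ) : ℕ∞) := by
    have := (WithBot.coe_le_coe.mpr hle).trans (h1.trans hdim)
    exact_mod_cast this
  have h3 : P.asIdeal.height + (j : ℕ∞) ≤ (d : ℕ∞) + j := by
    have := WithBot.coe_le_coe.mp h2
    rw [Nat.cast_add, add_comm (j : ℕ∞) d] at this
    exact this
  have h4 : P.asIdeal.height ≤ d := (ENat.add_le_add_iff_right (ENat.coe_ne_top j)).mp h3
  rw [IsLocalization.AtPrime.ringKrullDim_eq_height P.asIdeal (Localization.AtPrime P.asIdeal)]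
  exact_mod_cast h4

/-- **G-HT, chart shape** (`d = 3`, units in every degree `e • χ`). [folklore] -/
theorem ghtChart_holds : GHTChartStatement :=
  ghtChart_of_ght ght_holds

end Summit.ResolutionOfSingularities.ResolutionOfSingularities.Cruxes.HypersurfaceCentreConstruction.LocalEngine
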